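import Literature.Geometry.Lorentzian.MinkowskiStabilityBieriCauchy
import HarnessLib

/-!
# Stability of Minkowski space in Bieri's class B, pinned form over vacuum Cauchy developments

`MinkowskiStabilityBieriCauchy` declares the named fact
`christodoulou_klainerman_bieri_stability_minkowski_cauchy` with the regularity/decay currency
`(s, δ)` EXISTENTIAL and the Christodoulou–Klainerman fall-off `IsStronglyAsymptoticallyFlatCK`
(`= IsStronglyAsymptoticallyFlatWith M (3/2) (5/2) 4 3`, CK 1993 (1.0.9)).  This module declares the
PINNED variant in Bieri's own class B, over the SAME tree vocabulary and with no new definition: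

* Bieri, JDG 86 (2010) = arXiv:0904.0620, Def. 2 (AFB), arXiv p. 3: "an asymptotically flat initial
  data set `(H₀, ḡ, k)` … for which there exists a coordinate system `(x¹, x², x³)` in a neighbourhood
  of infinity such that with `r = (∑ (xⁱ)²)^{1/2} → ∞`, it is: `ḡ_ij = δ_ij + o₃(r^{-1/2})`,
  `k_ij = o₂(r^{-3/2})`" ↦ `trivialAFEnd.IsStronglyAsymptoticallyFlatWith D M (1/2) (3/2) 3 2`
  (`AsymptoticFlatness`: `h − (1 + 2M/r)δ = o₃(r^{-1/2})`, `k = o₂(r^{-3/2})` in the chart of the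
  standard end of `ℝ³`; for every `M`, since `(2M/r)δ ∈ o₃(r^{-1/2})`; `M = 0` is the literal AFB);
* loc. cit., (16)–(17), arXiv p. 3: "`Q(a, x₀) = a⁻¹ ( ∫_{H₀} ( |k|² + (a² + d₀²)|∇k|² + (a² + d₀²)²|∇²k|² ) dμ_ḡ
  + ∫_{H₀} ( (a² + d₀²)|Ric|² + (a² + d₀²)²|∇Ric|² ) dμ_ḡ )`, where `a` is a positive scale factor, and
  `d₀` denotes the distance function from an arbitrarily chosen origin `x₀`" … "We consider
  asymptotically flat initial data sets for which the metric `ḡ` is complete and there exists a small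
  positive `ε` such that `inf_{x₀, a} Q(x₀, a) < ε`" ↦ `D.IsComplete` and smallness of the weighted
  Sobolev distance `InitialDataSet.dataWeightedSobolevEDist 3 (-1) D trivialData` (`h − δ ∈ H³₋₁`,
  `k ∈ H²₀`: at `a = 1`, `x₀ = 0` the weights `(1 + d₀²)^m` on `∇ᵐk`, `m ≤ 2`, and `(1 + d₀²)^{m−1}`
  on `∂ᵐh`, `m = 2, 3`, are the tree's `(1 + ‖x‖)^{2(δ+m)}` with `δ + 1 = 0` for the `k`-part and
  `δ = −1` for the `h`-part) — the CURRENCY SENTENCE (g2): `Q(1, 0) ≲ dist₃,₋₁²` once `h − δ` is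
  uniformly small (nonlinear `Ric`, `μ_ḡ ≍ dx`, `d₀ ≍ r`), a routine comparison NOT typed here, so that
  Bieri's `ε_B` yields an `ε` for the tree's distance; the fact keeps `ε` existential exactly as the
  print does ("there exists a small positive `ε`");
* loc. cit., Thm. 1, arXiv p. 3: "Any asymptotically flat, maximal initial data set, with complete
  metric `ḡ`, satisfying inequality (17), where the `ε` has to be taken sufficiently small, leads to a
  unique, globally hyperbolic, smooth and geodesically complete solution of the EV equations, foliated
  by the level sets of a maximal time function. This development is globally asymptotically flat",
  with (same page) "by geodesically complete is denoted what in GR is called g-complete which means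
  that every causal geodesic can be extended for all parameter values" ↦ the conclusion of
  `christodoulou_klainerman_bieri_stability_minkowski_cauchy` VERBATIM, over maximal vacuum Cauchy
  developments (`VacuumCauchyDevelopment.IsMaximal.asymptotics_of_isCausalGeodesicallyComplete` turns
  the printed existence statement into the consequence form, `….of_exists` below).

FAITHFULNESS: the hypothesis class is contained in Bieri's (vacuum constraints ✓, maximal ✓, complete ✓,
AFB ✓, `inf Q < ε_B` ⟸ `dist₃,₋₁ < ε` for `ε` small via (g2)), the conclusions are those of the
`(s, δ)`-existential fact — so the fact is WEAKER than print modulo (g2), and strictly closer to print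
than the existential fact (Bieri's decay class instead of CK's; Bieri's exponents instead of `∃ s δ`).

Provenance: decomp-fsc lens-2 g41, `CLASSB-g41.md` §2 (observation O-41-1 «ClassBNoQ»), statement text
verbatim; critic row 383 (ticket T-383-1).  NOT here: the domination
`classB → christodoulou_klainerman_bieri_stability_minkowski_cauchy` (it needs completeness of `ḡ` from
`dist₃,₋₁`-smallness, a weighted Sobolev sup-embedding the tree lacks), the monotonicity of
`dataWeightedSobolevEDist` in `(s, δ)`, anything about stationarity / periodicity / light trapping of
the developments (the "fate dictionary").
-/

noncomputable section

open Set

open scoped Manifold ContDiff Topology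

namespace Literature.Geometry.Lorentzian

/-- **Stability of Minkowski space in Bieri's class B, pinned consequence form over vacuum Cauchy
developments** (named fact).  There are a derivative order `k` and `ε > 0` such that: for every
initial data set `D = (h, k)` on `ℝ³ = Minkowski.slice` solving the vacuum constraints, **maximal**
(`IsMaximalData`, Bieri: "maximal"), **complete** (`IsComplete`, Bieri: "with complete metric `ḡ`"),
of Bieri's class AFB on the standard end for some mass parameter `M`
(`trivialAFEnd.IsStronglyAsymptoticallyFlatWith D M (1/2) (3/2) 3 2`: `h − (1 + 2M/r)δ = o₃(r^{-1/2})`,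
`k = o₂(r^{-3/2})`; arXiv:0904.0620 p. 3, Def. 2) and `ε`-close to the trivial data in the weighted
Sobolev distance `H³₋₁ × H²₀` (`dataWeightedSobolevEDist 3 (-1)`, the tree's currency for Bieri's
`inf_{x₀,a} Q(x₀, a) < ε`, (16)–(17) loc. cit., via the routine comparison `Q(1,0) ≲ dist₃,₋₁²` recorded
in the module docstring and NOT typed), every **maximal vacuum Cauchy development** `𝒟` of `D` is
causally geodesically complete (Bieri's g-completeness), has complete future null infinity in the
sojourn form and converges to Minkowski space on all of its carrier in `Cᵏ` — Bieri 2010, Thm. 1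
(arXiv p. 3, quoted in the module docstring) read over `VacuumCauchyDevelopment` exactly as
`christodoulou_klainerman_bieri_stability_minkowski_cauchy`, whose text this is with three token
edits (`∃ s, ∃ δ ∈ (-3/2,-1/2)` dropped; `…CK D M ↦ …With D M (1/2) (3/2) 3 2`; `D.IsComplete →`
inserted; `s δ ↦ 3 (-1)`).
[cite: Bieri2010JDG, Def. 2, (16)–(17) and Thm. 1 with the remark on g-completeness (arXiv p. 3)] -/
def bieri_stability_minkowski_cauchy_classB : Prop :=
  ∃ (k : ℕ), ∃ ε > (0 : ℝ),
    ∀ (D : InitialDataSet 𝓘(ℝ, E3) Minkowski.slice) [D.metric.HasLeviCivita],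
      D.IsVacuumConstraintSolution → D.IsMaximalData → D.IsComplete →
      (∃ M : ℝ, trivialAFEnd.IsStronglyAsymptoticallyFlatWith D M (1 / 2) (3 / 2) 3 2) →
      InitialDataSet.dataWeightedSobolevEDist 3 (-1) D trivialData < ENNReal.ofReal ε →
      ∀ 𝒟 : VacuumCauchyDevelopment D, 𝒟.IsMaximal → ∀ [𝒟.metric.HasLeviCivita],
        𝒟.metric.IsCausalGeodesicallyComplete ∧ 𝒟.HasCompleteFutureNullInfinity ∧
          𝒟.toSpacetime.ConvergesToMinkowski Set.univ k

/-- **The class-B fact follows from the printed existence statement** (Bieri 2010, Thm. 1, read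
over `VacuumCauchyDevelopment`: small class-B data lead to *a* causally geodesically complete vacuum
Cauchy development converging to Minkowski space) by the GENERIC tree step
`VacuumCauchyDevelopment.IsMaximal.asymptotics_of_isCausalGeodesicallyComplete` (a complete
development embeds ONTO every maximal one). [cite: Bieri2010JDG, Thm. 1 and the remark on g-completeness (arXiv p. 3)] -/
theorem bieri_stability_minkowski_cauchy_classB.of_exists
    (hex : ∃ (k : ℕ), ∃ ε > (0 : ℝ),
      ∀ (D : InitialDataSet 𝓘(ℝ, E3) Minkowski.slice) [D.metric.HasLeviCivita],
        D.IsVacuumConstraintSolution → D.IsMaximalData → D.IsComplete →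
        (∃ M : ℝ, trivialAFEnd.IsStronglyAsymptoticallyFlatWith D M (1 / 2) (3 / 2) 3 2) →
        InitialDataSet.dataWeightedSobolevEDist 3 (-1) D trivialData < ENNReal.ofReal ε →
        ∃ 𝒟₀ : VacuumCauchyDevelopment D,
          (∀ [𝒟₀.metric.HasLeviCivita], 𝒟₀.metric.IsCausalGeodesicallyComplete) ∧
            𝒟₀.toSpacetime.ConvergesToMinkowski Set.univ k) :
    bieri_stability_minkowski_cauchy_classB := by
  obtain ⟨k, ε, hε, H⟩ := hex
  refine ⟨k, ε, hε, fun D _ hD hmax hcpl hsaf hdist 𝒟 h𝒟 _ ↦ ?_⟩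
  obtain ⟨𝒟₀, hc, hconv⟩ := H D hD hmax hcpl hsaf hdist
  exact h𝒟.asymptotics_of_isCausalGeodesicallyComplete hc hconv

/-- **Small class-B data are dispersive**: under the fact, for the same `ε` every maximal vacuum
Cauchy development of maximal, complete, class-B, `ε`-small vacuum data on `ℝ³` is neither future
null geodesically incomplete nor future timelike geodesically incomplete (the conclusions of the
Penrose and Hawking singularity theorems are excluded).  Hawking–Ellis 1973, §8.1 (g-completeness
excludes incomplete causal geodesics); Bieri 2010, Thm. 1. [cite: HawkingEllis1973, §8.1, pp. 257–258] -/
theorem bieri_stability_minkowski_cauchy_classB.not_incomplete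
    (h : bieri_stability_minkowski_cauchy_classB) :
    ∃ ε > (0 : ℝ),
      ∀ (D : InitialDataSet 𝓘(ℝ, E3) Minkowski.slice) [D.metric.HasLeviCivita],
        D.IsVacuumConstraintSolution → D.IsMaximalData → D.IsComplete →
        (∃ M : ℝ, trivialAFEnd.IsStronglyAsymptoticallyFlatWith D M (1 / 2) (3 / 2) 3 2) →
        InitialDataSet.dataWeightedSobolevEDist 3 (-1) D trivialData < ENNReal.ofReal ε →
        ∀ 𝒟 : VacuumCauchyDevelopment D, 𝒟.IsMaximal → ∀ [𝒟.metric.HasLeviCivita],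
          ¬ 𝒟.metric.IsFutureNullGeodesicallyIncomplete 𝒟.timeOrientation ∧
            ¬ 𝒟.metric.IsFutureTimelikeGeodesicallyIncomplete 𝒟.timeOrientation := by
  obtain ⟨k, ε, hε, H⟩ := h
  refine ⟨ε, hε, fun D _ hD hmax hcpl hsaf hdist 𝒟 h𝒟 _ ↦ ?_⟩
  obtain ⟨hcc, -, -⟩ := H D hD hmax hcpl hsaf hdist 𝒟 h𝒟
  obtain ⟨htl, hnull⟩ := (𝒟.metric.isCausalGeodesicallyComplete_iff).1 hcc
  haveI := LorentzianMetric.contMDiffCovariantDerivative_leviCivita_one 𝒟.metric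
  exact ⟨fun hinc ↦
      LorentzianMetric.not_isNullGeodesicallyComplete_of_isFutureNullGeodesicallyIncomplete_holds
        𝒟.timeOrientation hinc hnull,
    fun hinc ↦
      LorentzianMetric.not_isTimelikeGeodesicallyComplete_of_isFutureTimelikeGeodesicallyIncomplete_holds
        𝒟.timeOrientation hinc htl⟩

/-- **CK fall-off is class B**: Christodoulou–Klainerman's strong asymptotic flatness
`h − (1 + 2M/r)δ = o₄(r^{-3/2})`, `k = o₃(r^{-5/2})` implies Bieri's AFB fall-off
`o₃(r^{-1/2})`, `o₂(r^{-3/2})` with the same mass parameter (slower rates, fewer derivatives: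
`‖x‖^{-β-m} ≤ ‖x‖^{-β'-m}` for `β' ≤ β` and `‖x‖ ≥ 1`).  Bieri 2010, arXiv p. 3 (Def. 2 vs. Def. 3,
SAFCK ⊂ AFB). [cite: Bieri2010JDG, Def. 2 and Def. 3 (arXiv p. 3)] -/
theorem AFEnd.IsStronglyAsymptoticallyFlatCK.classB {X : Type*} [TopologicalSpace X] [ChartedSpace E3 X]
    [IsManifold (𝓡 3) ∞ X] {e : AFEnd X} {D : InitialDataSet (𝓡 3) X} {M : ℝ}
    (h : e.IsStronglyAsymptoticallyFlatCK D M) :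
    e.IsStronglyAsymptoticallyFlatWith D M (1 / 2) (3 / 2) 3 2 := by
  have hmono : ∀ (β β' : ℝ) (m : ℕ), β' ≤ β →
      (fun x : E3 ↦ ‖x‖ ^ (-β - m)) =O[Bornology.cobounded E3] fun x ↦ ‖x‖ ^ (-β' - m) := by
    intro β β' m hββ'
    refine Asymptotics.IsBigO.of_bound 1 ?_
    have h1 : ∀ᶠ x : E3 in Bornology.cobounded E3, 1 ≤ ‖x‖ := by
      have := (Metric.hasBasis_cobounded_compl_closedBall (0 : E3)).mem_of_mem (i := 1) trivial
      filter_upwards [this] with x hx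
      simp only [mem_compl_iff, Metric.mem_closedBall, dist_zero_right, not_le] at hx
      exact hx.le
    filter_upwards [h1] with x hx
    rw [one_mul, Real.norm_of_nonneg (Real.rpow_nonneg (norm_nonneg _) _),
      Real.norm_of_nonneg (Real.rpow_nonneg (norm_nonneg _) _)]
    exact Real.rpow_le_rpow_of_exponent_le hx (by linarith)
  refine ⟨fun m hm ↦ ?_, fun m hm ↦ ?_⟩
  · exact (h.1 m (by omega)).trans_isBigO (hmono (3 / 2) (1 / 2) m (by norm_num))
  · exact (h.2 m (by omega)).trans_isBigO (hmono (5 / 2) (3 / 2) m (by norm_num))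

end Literature.Geometry.Lorentzian

end
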